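import Literature.Analysis.FluidPDE.ParabolicSobolevHolderEmbeddingHolds
import HarnessLib

/-!
# `StokesLocalHolderBound` reduced to Seregin's Prop. 6.7 alone

Analysis/FluidPDE proofs file (theorems only) on the path of the named fact
`Literature.Analysis.FluidPDE.StokesLocalHolderBound` (`FluidPDE/SereginLocalStokesRegularity`;
G. Seregin, *Lecture notes on regularity theory for the Navier–Stokes equations* (2014), §4.6,
Prop. 6.7 followed by Prop. 6.8; the instance `(s,n) = (6, 3/2)` is the last step of
Seregin–Šverák 2009, §4 p. 11).

`FluidPDE/SereginLocalStokesW21` reduced the fact to the two printed propositions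
(`StokesLocalHolderBound_of : StokesLocalW21Estimate → ParabolicSobolevHolderEmbedding →
StokesLocalHolderBound`), and the parabolic embedding Prop. 6.8 has since been PROVED
(`ParabolicSobolevHolderEmbedding_holds`, `FluidPDE/ParabolicSobolevHolderEmbeddingHolds`: heat
potential of the cut-off field, caloric duality, the `L¹`-Morrey bound of `L_{s,n}` data and the
Hölder theorem for parabolic singular potentials). Hence the only remaining input is Prop. 6.7,
the local `W^{2,1}_{s,n}` regularity of the non-stationary Stokes system (Solonnikov's coercive
`L_{s,n}` estimates, Thm. 4.5 of the book, plus the corrector/duality argument of pp. 58–60):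

* `StokesLocalHolderBound_of_stokesLocalW21Estimate : StokesLocalW21Estimate → StokesLocalHolderBound`.

## References

* G. Seregin, *Lecture notes on regularity theory for the Navier–Stokes equations*, World
  Scientific (2014), §4.6 Prop. 6.7 (p. 58), Prop. 6.8 (p. 60). [`Seregin2014`]
* G. Seregin, V. Šverák, Comm. PDE 34 (2009) = arXiv:0804.1803, §4 p. 11. [`SereginSverak2009`]
-/

noncomputable section

namespace Literature.Analysis.FluidPDE

/-- **`StokesLocalHolderBound` follows from Seregin 2014, Prop. 6.7 alone** (the embedding
Prop. 6.8 being proved): the parabolic Hölder bound for distributional solutions of the Stokes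
system in `W^{1,0}_{s,n} × L_{s,n}` with `L_{s,n}` force, `1 < n ≤ 2`, `μ = 2 - 2/n - 3/s > 0`, on
every interior cylinder `Q(z,r) ⊂ Q(z,R)`, with a constant linear in the data.
[cite: Seregin2014, §4.6 Prop. 6.7 (4.6.4) and Prop. 6.8 (pp. 58–60)] -/
theorem StokesLocalHolderBound_of_stokesLocalW21Estimate (h : StokesLocalW21Estimate) :
    StokesLocalHolderBound :=
  StokesLocalHolderBound_of h ParabolicSobolevHolderEmbedding_holds

end Literature.Analysis.FluidPDE

end
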